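import Mathlib.RingTheory.Derivation.Basic
import Literature.AlgebraicGeometry.Resolution.QuadraticTransforms

/-!
# The initial derivation of the quadratic sequence along a discrete rank-one valuation

Helper file for the line `pfaff-line-log-final-forms` of the crux `Valuative.LuAlphaPTorsor`
(item `stmt-ResolutionOfSingularities-0641`), immediate case along DISCRETE rank-one valuations
(registered helper stub `discreteSequence_initialDerivation`, layer L2a of the lead's analysis).

Setting, abstracted to one stage `S = R_{i₀}` of the quadratic sequence: `S` is a subring of the
field `K'` dominated by the valuation ring `O'`; `π ∈ S` is a non-unit of MAXIMAL value among the
non-units of `S`; `(π, y)` generates the non-units of `S` element-wise; `Dπ, Dy` are the dual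
derivations of `K'` preserving `S` (`Dπ π = 1`, `Dπ y = 0`, `Dy π = 0`, `Dy y = 1`); and `D` is
ANY derivation of `K'` preserving `S` with `D a ≠ 0`. PROVED
(`discreteSequence_initialDerivation`): there are `π'` of the same value as `π`, with `(π', y)`
still generating the non-units, and a derivation `D₀` preserving `S` with `D₀ π' = 0` and
`D₀ a ≠ 0`. Three cases:

* `Dy a ≠ 0`: `π' := π`, `D₀ := Dy`;
* `Dy a = 0 ≠ Dπ a`: `π' := π + y ^ M`, `D₀ := Dy - (M y^{M-1}) • Dπ` (`M ≥ 2`, `M ≠ 0` in `K'`):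
  `D₀ π' = M y^{M-1} - M y^{M-1} = 0`, `D₀ a = -M y^{M-1} Dπ a ≠ 0`, `v(y^M) ≤ v(π)^M < v(π)` so
  `v(π') = v(π)`, and `b π + c y = b π' + (c - b y^{M-1}) y`;
* `Dy a = 0 = Dπ a`: `π' := π`, `D₀ := D - (D π) • Dπ - (D y) • Dy`.

All [folklore] (elementary calculus of derivations on a two-dimensional regular local ring with a
regular system of parameters `(π, y)`; Zariski; Abhyankar 1956, §2).
-/

set_option linter.dupNamespace false

namespace Summit.ResolutionOfSingularities.ResolutionOfSingularities.Theorems.PfaffLine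

open Literature.AlgebraicGeometry.Resolution

/-- **Initial derivation** (layer L2a of the discrete rank-one case of the line
`pfaff-line-log-final-forms`). At a stage `S` of the quadratic sequence dominated by `O'`, with
`π ∈ S` a non-unit of maximal value, `(π, y)` generating the non-units of `S`, dual derivations
`Dπ, Dy` of `K'` preserving `S`, and a derivation `D` preserving `S` with `D a ≠ 0`: there are
`π'` of the same value as `π` with `(π', y)` still generating the non-units, and a derivation
`D₀` preserving `S` with `D₀ π' = 0` and `D₀ a ≠ 0`. [folklore] -/
theorem discreteSequence_initialDerivation :
    ∀ (K' : Type) [Field K'] (O' : ValuationSubring K') (S : Subring K') (π y a : K') (Dπ Dy D : Derivation ℤ K' K') (M : ℕ), Literature.AlgebraicGeometry.Resolution.SubringDominates S O'.toSubring → (∀ z : K', z ∈ S → z⁻¹ ∉ S → O'.valuation z ≤ O'.valuation π) → π ∈ S → π⁻¹ ∉ S → y ∈ S → y⁻¹ ∉ S → (∀ z : K', z ∈ S → z⁻¹ ∉ S → ∃ b ∈ S, ∃ c ∈ S, z = b * π + c * y) → (∀ z : K', z ∈ S → Dπ z ∈ S) → (∀ z : K', z ∈ S → Dy z ∈ S)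 → (∀ z : K', z ∈ S → D z ∈ S) → Dπ π = 1 → Dπ y = 0 → Dy π = 0 → Dy y = 1 → a ∈ S → D a ≠ 0 → 2 ≤ M → ((M : ℕ) : K') ≠ 0 → ∃ (π' : K') (D₀ : Derivation ℤ K' K'), π' ∈ S ∧ O'.valuation π' = O'.valuation π ∧ (∀ z : K', z ∈ S → z⁻¹ ∉ S → ∃ b ∈ S, ∃ c ∈ S, z = b * π' + c * y) ∧ (∀ z : K', z ∈ S → D₀ z ∈ S) ∧ D₀ π' = 0 ∧ D₀ a ≠ 0 := by
  intro K' _ O' S π y a Dπ Dy D M hdom hmax hπS hπinv hyS hyinv hgen hDπS hDyS hDS hDππ _hDπy hDyπ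
    hDyy _haS hDa hM hMK
  rcases ne_or_eq (Dy a) 0 with hDya | hDya
  · -- Case 1: `Dy a ≠ 0`.
    exact ⟨π, Dy, hπS, rfl, hgen, hDyS, hDyπ, hDya⟩
  rcases ne_or_eq (Dπ a) 0 with hDπa | hDπa
  · -- Case 2: `Dy a = 0 ≠ Dπ a`; `π' := π + y ^ M`, `D₀ := Dy - (M y^{M-1}) • Dπ`.
    obtain ⟨m, rfl⟩ : ∃ m, M = m + 1 := ⟨M - 1, by omega⟩
    have hy0 : y ≠ 0 := by
      rintro rfl
      exact hyinv (by rw [inv_zero]; exact S.zero_mem)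
    have hπ0 : π ≠ 0 := by
      rintro rfl
      exact hπinv (by rw [inv_zero]; exact S.zero_mem)
    -- `0 < v(π) < 1`: `π` is a non-zero non-unit of `S`, and `O'` dominates `S`.
    have hvπ0 : 0 < O'.valuation π :=
      pos_iff_ne_zero.mpr ((Valuation.ne_zero_iff _).mpr hπ0)
    have hvπ1 : O'.valuation π < 1 := by
      refine lt_of_le_of_ne ((O'.valuation_le_one_iff π).mpr (hdom.1 hπS)) fun h1 => hπinv ?_
      refine hdom.2 π hπS ((O'.valuation_le_one_iff _).mp ?_)
      rw [map_inv₀, h1, inv_one]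
    have hvyM : O'.valuation (y ^ (m + 1)) < O'.valuation π := by
      rw [map_pow]
      calc O'.valuation y ^ (m + 1) ≤ O'.valuation π ^ (m + 1) :=
            pow_le_pow_left₀ zero_le (hmax y hyS hyinv) _
        _ < O'.valuation π := pow_lt_self_of_lt_one₀ hvπ0 hvπ1 (by omega)
    refine ⟨π + y ^ (m + 1), Dy - (((m + 1 : ℕ) : K') * y ^ m) • Dπ,
      S.add_mem hπS (S.pow_mem hyS _), ?_, ?_, ?_, ?_, ?_⟩
    · -- value
      exact Valuation.map_add_eq_of_lt_left _ hvyM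
    · -- generation: `b π + c y = b π' + (c - b y^m) y`
      intro z hz hzi
      obtain ⟨b, hb, c, hc, hzbc⟩ := hgen z hz hzi
      refine ⟨b, hb, c - b * y ^ m, S.sub_mem hc (S.mul_mem hb (S.pow_mem hyS _)), ?_⟩
      rw [hzbc]
      ring
    · -- `D₀` preserves `S`
      intro z hz
      rw [Derivation.sub_apply, Derivation.smul_apply, smul_eq_mul]
      exact S.sub_mem (hDyS z hz)
        (S.mul_mem (S.mul_mem (natCast_mem S _) (S.pow_mem hyS _)) (hDπS z hz))
    · -- `D₀ π' = 0`
      rw [Derivation.sub_apply, Derivation.smul_apply, smul_eq_mul, map_add, map_add,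
        Derivation.leibniz_pow, Derivation.leibniz_pow, hDππ, hDyπ, hDyy, _hDπy]
      simp only [Nat.add_sub_cancel, smul_eq_mul, nsmul_eq_mul, mul_zero, mul_one, add_zero,
        zero_add]
      ring
    · -- `D₀ a ≠ 0`
      rw [Derivation.sub_apply, Derivation.smul_apply, smul_eq_mul, hDya, zero_sub, neg_ne_zero]
      exact mul_ne_zero (mul_ne_zero hMK (pow_ne_zero _ hy0)) hDπa
  · -- Case 3: `Dy a = 0 = Dπ a`; `π' := π`, `D₀ := D - (D π) • Dπ - (D y) • Dy`.
    refine ⟨π, D - (D π) • Dπ - (D y) • Dy, hπS, rfl, hgen, ?_, ?_, ?_⟩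
    · intro z hz
      rw [Derivation.sub_apply, Derivation.sub_apply, Derivation.smul_apply,
        Derivation.smul_apply, smul_eq_mul, smul_eq_mul]
      exact S.sub_mem (S.sub_mem (hDS z hz) (S.mul_mem (hDS π hπS) (hDπS z hz)))
        (S.mul_mem (hDS y hyS) (hDyS z hz))
    · rw [Derivation.sub_apply, Derivation.sub_apply, Derivation.smul_apply,
        Derivation.smul_apply, smul_eq_mul, smul_eq_mul, hDππ, hDyπ]
      ring
    · rw [Derivation.sub_apply, Derivation.sub_apply, Derivation.smul_apply,
        Derivation.smul_apply, smul_eq_mul, smul_eq_mul, hDπa, hDya, mul_zero, mul_zero,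
        sub_zero, sub_zero]
      exact hDa

end Summit.ResolutionOfSingularities.ResolutionOfSingularities.Theorems.PfaffLine
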